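import Summits.AtomisticToContinuum.Crystallization.Theses.ReggeStarCoercivity
import Summits.AtomisticToContinuum.Crystallization.Theorems.ReggeStarCoercivityStarCoercivitySeparationRemoval

/-!
# Line `elastic-tier-overlap-split` for crux `ReggeStarCoercivity.StarCoercivity`
# (item stmt-AtomisticToContinuum-13600) — CHECKED SKELETON (crux-plan, round 1)

Crux (by name, concluded by `StarCoercivity_of` below):
`Summit.AtomisticToContinuum.Crystallization.Theses.ReggeStarCoercivity.StarCoercivity` =
`∃ g > 0, ∃ C, ∀ N, ∀ x : Fin N → ℝ³ injective, N·e_per + g·#Def₁⁄₂₀(x) − C·N^(2/3) ≤ E_LJ(x)`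
(`starCoercivity_iff` below is `Iff.rfl`: the vocabulary `ePer`, `shell`, `CloseAt θ`, `defectsAt θ`
of this file is the crux's own sub-expressions with the matching tolerance `1/20` made a parameter `θ`).

The line (idea card `elastic-tier-overlap-split`, triage r1-1/2/3: pass, merged with
`threshold-substitution-handover` ≈ `handover-tolerance-ladder` into ONE two-tier handover line):

  S1 `stub_separationRemoval`  WLOG `1/3`-separated (closest-pair deletion: a particle of a pair at
                               distance `< 1/3` has positive site energy, deleting it lowers the energy
                               and frees at most 55 other sites; induction on `N`, `g ↦ min(g, |e_per|/56)`).
                               Injectivity of the crux is consumed HERE (Disproof §4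
                               `not_starCoercivityNonInj`: any proof must use it).
  S2 `stub_elasticTier`        THE NEAR (ELASTIC) TIER: `∃ κ > 0, ∃ C_b C, ∀ 1/3-separated x,
                               N·e_per + κ·#Def₁⁄₂₀(x) − C_b·#Def₁⁄₁₅(x) − C·N^(2/3) ≤ E_LJ(x)` — every
                               1/20-defective site costs `κ`, EXCEPT that each 1/15-GROSS site (not
                               1/15-close to fcc/hcp at any admissible dilation: wrong coordination,
                               wrong contact graph, or ≥ 1/15 bottleneck distortion; surface sites
                               included) may be charged back a FLAT amount `C_b` (collar attribution:
                               the `≤ K_R` sites within `R` of a gross site, their crude site-energy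
                               floor and the boundary flux of the elastic estimate are all paid per
                               gross site).  Reference-lattice mathematics only: robust layer lemma at
                               tolerance 1/15 (< graph-forcing ceiling (√2−1)/4), harmonic coercivity
                               of every Barlow stacking near its own scale, equation-of-state rung away
                               from it; NO Delaunay stars, NO e_per value (e(S) ≥ e_per by `ciInf_le`).
  S3 `stub_coarseTier`         THE FAR (LP) TIER at the COARSE tolerance: `∃ g₁ > 0, ∃ C, ∀ 1/3-separated
                               x, N·e_per + g₁·#Def₁⁄₁₅(x) − C·N^(2/3) ≤ E_LJ(x)` — the route's
                               Regge/Delaunay-star LP programme, but charging only 1/15-gross sites, so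
                               the certificate must resolve `≈ 1e-2` (threshold slip at 1/15: 9.3e-3 per
                               charged site; FK phases ~1e-2; bcc 3.1e-2; vacancy 6e-2) instead of the
                               crux's `5.7e-3`, and never prices a 1/20-threshold configuration.

`composition : S1 → S2 → S3 → (crux unfolded)` is the CONVEX-COMBINATION GLUE (no sorry, no stub used):
with `B = max C_b 0`, `g₁·(S2) + B·(S3)` divided by `g₁ + B` gives the separated crux with
`g = g₁κ/(g₁ + B) > 0`, `C = (g₁C₂ + B·C₃)/(g₁ + B)` — the charge-back term cancels EXACTLY, for every
flat constant `C_b`, so no levy inequality `g_far > C_far + K·C_near` is ever needed (triage objection (a)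
dissolved at the level of global inequalities); S1 then removes the separation hypothesis.
`StarCoercivity_of : StarCoercivity` (by name, hypothesis-free: obligation tags are gate-reserved) is
`composition` fed with the three registered stubs; it carries no sorry of its own and becomes the crux proof
the moment the stubs land.
-/

/-!
## RESHAPE r1 (second line lead prover-line-stmt-AtomisticToContinuum-13600-b-0, 2026-08-16, cycle 1)

S3 `stub_coarseTier` is no longer a stub: it is DERIVED (`coarseTier_of_stubs`, no sorry) from two registered stubs
  S3p `stub_coarseTierPeriodic`  — the far tier ON THE TORUS: `∃ g₁ > 0, ∀ P : PeriodicConfiguration 3` whose point set is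
                                  `1/3`-separated, `e_per + g₁·(#1/15-gross motif points)/#motif ≤ e(P)` (shells read in `P.points`,
                                  verbatim the dress of item 13602 `PeriodicStarCoercivity` with tolerance `1/15` and separation added).
                                  THE HARD CORE (XL): finite Delaunay complex on ℝ³/Λ, exact flatness (13607/13608), no boundary, `C = 0`.
  S3t `stub_coarseTierTransfer`  — TRANSFER (M): S3p → S3 with `C = 0`, by periodising a separated `x` with the cubic lattice of period
                                  `2Σ‖xᵢ‖ + 2` (Disproof §5/§9 pattern: the periodisation is `1/3`-separated, its shells read in `P.points`
                                  are the shells of `x` at ANY tolerance, `#motif = N`, `e(P) ≤ E_LJ(x)/N` since cross terms are `V_LJ ≤ 0`).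
S1, S2 unchanged. Stub count 4 ≤ stubs_max 7. `StarCoercivity_of` still concludes the crux BY NAME with no sorry of its own.
-/

/-!
## RESHAPE r2 (lead b-0, cycle 1, after wave 1)

* S1 `stub_separationRemoval` LANDED (p85777, `Theorems/ReggeStarCoercivityStarCoercivitySeparationRemoval.lean`,
  `Summit.AtomisticToContinuum.Crystallization.Theorems.stub_separationRemoval`); the skeleton now cites it (no sorry).
* S2 `stub_elasticTier` is DERIVED (`elasticTier_of_stubs`, no sorry) from two registered stubs:
  S2a `stub_regionalEngine` — THE NEAR-TIER CORE (XL⁻): on the region `Ω_R(x)` of sites all of whose `R`-neighbours are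
      `1/15`-close, `κ·#(Ω_R ∩ Def₁⁄₂₀) − C_f·#Def₁⁄₁₅ ≤ Σ_{i∈Ω_R} (½𝓔ⁱ(x) − e_per)` for all `1/3`-separated `x`
      (harmonic coercivity of Barlow stackings + robust layer lemma at 1/15 + far-field/boundary flux charged per gross site);
  S2g `stub_elasticTierGlue` — BOOKKEEPING GLUE (M, proof ready from wave 1): S2a → S2 with
      `C_b = (6R+1)³(|e_per| + κ + 30375/2) + C_f`, `C = 0` (`E = ½Σ𝓔ⁱ`, site-energy floor `½𝓔ⁱ ≥ −30375/2` on
      `1/3`-separated `x`, packing count `#Ω_Rᶜ ≤ (6R+1)³·#Def₁⁄₁₅`).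
* S3p/S3t signatures respelled with a type ascription instead of the named argument `(K := …)` (the stub extractor cuts
  at the first `:=`; wave-1 finding) — same elaborated terms.
Registered stubs after r2: stub_regionalEngine (XL⁻ core), stub_elasticTierGlue (M), stub_coarseTierPeriodic (XL core, lead),
stub_coarseTierTransfer (M, proof ready).  `StarCoercivity_of` concludes the crux BY NAME with no sorry of its own.
-/

noncomputable section

open scoped BigOperators Classical

namespace Summit.AtomisticToContinuum.Crystallization.Cruxes.StarCoercivity.ElasticTierOverlapSplit

open Summit.AtomisticToContinuum.Crystallization.Theses.ReggeStarCoercivity (StarCoercivity)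
open Literature.MathematicalPhysics.StatisticalMechanics Literature.Geometry.DiscreteGeometry

local notation "E3" => EuclideanSpace ℝ (Fin 3)

/-! ## Vocabulary (transparent abbreviations of the crux's own sub-expressions) -/

/-- `e_per = ⨅_Q e(Q)` over periodic configurations of `ℝ³` (verbatim from the crux). -/
def ePer : ℝ := ⨅ Q : PeriodicConfiguration 3, Q.energyPerParticle lennardJones

/-- The recentred first shell of site `i` (absolute radius `6/5`), rescaled by `a⁻¹` (verbatim from the crux). -/
def shell {N : ℕ} (x : Fin N → E3) (i : Fin N) (a : ℝ) : Finset E3 :=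
  (Finset.univ.filter fun j : Fin N => j ≠ i ∧ dist (x i) (x j) ≤ 6 / 5).image fun j => a⁻¹ • (x j - x i)

/-- Site `i` is `θ`-CLOSE TO BARLOW: some admissible dilation `a ∈ [9/10, 11/10]` makes its rescaled shell
`θ`-matched (bijectively, after a linear isometry) to the fcc or the hcp kissing pattern.  At `θ = 1/20` this
is verbatim the crux's goodness; `¬ CloseAt (1/15)` is this line's GROSS defectiveness (handover tolerance
`1/15 = 0.0667`: below the γ-surface inflection `≈ 0.075` of the {111}⟨112⟩ slip family and below the
graph-forcing ceiling `(√2 − 1)/4 = 0.1036`; icosahedral shells sit at bottleneck `0.23`). -/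
def CloseAt (θ : ℝ) {N : ℕ} (x : Fin N → E3) (i : Fin N) : Prop :=
  ∃ a : ℝ, 9 / 10 ≤ a ∧ a ≤ 11 / 10 ∧
    (ShellCloseTo θ (shell x i a) fccKissingPattern ∨ ShellCloseTo θ (shell x i a) hcpKissingPattern)

/-- Number of `θ`-defective sites; `defectsAt (1/20) x` is verbatim the crux's defect count. -/
def defectsAt (θ : ℝ) {N : ℕ} (x : Fin N → E3) : ℕ := Nat.card {i : Fin N // ¬ CloseAt θ x i}

/-- `1/3`-separation (implies injectivity; WLOG by S1; `1/3 < 500^(−1/6)`, the radius below which a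
Lennard-Jones site energy is positive by `sum_inv_pow_six_le`). -/
def Separated {N : ℕ} (x : Fin N → E3) : Prop := ∀ i j : Fin N, i ≠ j → (1 / 3 : ℝ) ≤ dist (x i) (x j)

/-- The crux restated through this file's vocabulary (definitional). -/
theorem starCoercivity_iff :
    StarCoercivity ↔ ∃ g : ℝ, 0 < g ∧ ∃ C : ℝ, ∀ (N : ℕ) (x : Fin N → E3), Function.Injective x →
      (N : ℝ) * ePer + g * (defectsAt (1 / 20) x : ℝ) - C * (N : ℝ) ^ (2 / 3 : ℝ) ≤
        interactionEnergy lennardJones x :=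
  Iff.rfl

/-! ## The three statement blocks of the line -/

/-- **S1 — separation removal.** The crux restricted to `1/3`-separated configurations (with any slack
`C`) implies the crux. -/
def SeparationRemoval : Prop :=
  (∃ g : ℝ, 0 < g ∧ ∃ C : ℝ, ∀ (N : ℕ) (x : Fin N → E3), Separated x →
      (N : ℝ) * ePer + g * (defectsAt (1 / 20) x : ℝ) - C * (N : ℝ) ^ (2 / 3 : ℝ) ≤
        interactionEnergy lennardJones x) →
    ∃ g : ℝ, 0 < g ∧ ∃ C : ℝ, ∀ (N : ℕ) (x : Fin N → E3), Function.Injective x →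
      (N : ℝ) * ePer + g * (defectsAt (1 / 20) x : ℝ) - C * (N : ℝ) ^ (2 / 3 : ℝ) ≤
        interactionEnergy lennardJones x

/-- **S2 — the near (elastic) tier.** Every `1/20`-defective site of a `1/3`-separated configuration costs
`κ > 0`, up to a flat charge-back `C_b` per `1/15`-gross site and a boundary slack `C·N^(2/3)`. -/
def ElasticTier : Prop :=
  ∃ κ : ℝ, 0 < κ ∧ ∃ Cb C : ℝ, ∀ (N : ℕ) (x : Fin N → E3), Separated x →
    (N : ℝ) * ePer + κ * (defectsAt (1 / 20) x : ℝ) - Cb * (defectsAt (1 / 15) x : ℝ)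
        - C * (N : ℝ) ^ (2 / 3 : ℝ) ≤ interactionEnergy lennardJones x

/-- **S3 — the far (LP) tier at the coarse tolerance.** Every `1/15`-gross site of a `1/3`-separated
configuration costs `g₁ > 0`, up to a boundary slack `C·N^(2/3)`. -/
def CoarseTier : Prop :=
  ∃ g₁ : ℝ, 0 < g₁ ∧ ∃ C : ℝ, ∀ (N : ℕ) (x : Fin N → E3), Separated x →
    (N : ℝ) * ePer + g₁ * (defectsAt (1 / 15) x : ℝ) - C * (N : ℝ) ^ (2 / 3 : ℝ) ≤
      interactionEnergy lennardJones x


/-- **S3p — the far (LP) tier ON THE TORUS** (reshape r1): for every periodic configuration of `ℝ³` whose point set is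
`1/3`-separated, `e_per + g₁ · (fraction of 1/15-gross motif points) ≤ e(P)`; shells are read in `P.points` exactly as in
item 13602 `PeriodicStarCoercivity`, with tolerance `1/15`. -/
def CoarseTierPeriodic : Prop :=
  ∃ g₁ : ℝ, 0 < g₁ ∧ ∀ P : PeriodicConfiguration 3,
    (∀ u ∈ P.points, ∀ v ∈ P.points, u ≠ v → (1 / 3 : ℝ) ≤ dist u v) →
    ePer + g₁ * ((P.motif.filter fun s => ¬ ∃ a : ℝ, 9 / 10 ≤ a ∧ a ≤ 11 / 10 ∧
        (ShellCloseTo (1 / 15) ((P.finite_inter_points (Metric.isBounded_closedBall.subset Set.sdiff_subset :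
            Bornology.IsBounded (Metric.closedBall s (6 / 5) \ {s}))).toFinset.image fun y => a⁻¹ • (y - s)) fccKissingPattern ∨
          ShellCloseTo (1 / 15) ((P.finite_inter_points (Metric.isBounded_closedBall.subset Set.sdiff_subset :
            Bornology.IsBounded (Metric.closedBall s (6 / 5) \ {s}))).toFinset.image fun y => a⁻¹ • (y - s)) hcpKissingPattern)).card : ℝ)
        / (P.motif.card : ℝ) ≤ P.energyPerParticle lennardJones

/-! ## Registered stubs (the only sorries of the file; signatures spelled out over tree declarations —
`SeparationRemoval` / `ElasticTier` / `CoarseTier` are the same texts, certified by the `example`s) -/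

/-- S1 — separation removal by closest-pair deletion: LANDED in wave 1 (p85777) as
`Summit.AtomisticToContinuum.Crystallization.Theorems.stub_separationRemoval`; cited here, no sorry. -/
theorem stub_separationRemoval :
    (∃ g : ℝ, 0 < g ∧ ∃ C : ℝ, ∀ (N : ℕ) (x : Fin N → EuclideanSpace ℝ (Fin 3)),
        (∀ i j : Fin N, i ≠ j → (1 / 3 : ℝ) ≤ dist (x i) (x j)) →
        (N : ℝ) * (⨅ Q : PeriodicConfiguration 3, Q.energyPerParticle lennardJones)
            + g * (Nat.card {i : Fin N // ¬ ∃ a : ℝ, 9 / 10 ≤ a ∧ a ≤ 11 / 10 ∧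
                (ShellCloseTo (1 / 20) ((Finset.univ.filter fun j : Fin N => j ≠ i ∧ dist (x i) (x j) ≤ 6 / 5).image
                    fun j => a⁻¹ • (x j - x i)) fccKissingPattern ∨
                  ShellCloseTo (1 / 20) ((Finset.univ.filter fun j : Fin N => j ≠ i ∧ dist (x i) (x j) ≤ 6 / 5).image
                    fun j => a⁻¹ • (x j - x i)) hcpKissingPattern)} : ℝ)
            - C * (N : ℝ) ^ (2 / 3 : ℝ) ≤ interactionEnergy lennardJones x) →
      ∃ g : ℝ, 0 < g ∧ ∃ C : ℝ, ∀ (N : ℕ) (x : Fin N → EuclideanSpace ℝ (Fin 3)), Function.Injective x →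
        (N : ℝ) * (⨅ Q : PeriodicConfiguration 3, Q.energyPerParticle lennardJones)
            + g * (Nat.card {i : Fin N // ¬ ∃ a : ℝ, 9 / 10 ≤ a ∧ a ≤ 11 / 10 ∧
                (ShellCloseTo (1 / 20) ((Finset.univ.filter fun j : Fin N => j ≠ i ∧ dist (x i) (x j) ≤ 6 / 5).image
                    fun j => a⁻¹ • (x j - x i)) fccKissingPattern ∨
                  ShellCloseTo (1 / 20) ((Finset.univ.filter fun j : Fin N => j ≠ i ∧ dist (x i) (x j) ≤ 6 / 5).image
                    fun j => a⁻¹ • (x j - x i)) hcpKissingPattern)} : ℝ)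
            - C * (N : ℝ) ^ (2 / 3 : ℝ) ≤ interactionEnergy lennardJones x :=
  Summit.AtomisticToContinuum.Crystallization.Theorems.stub_separationRemoval

example : SeparationRemoval := stub_separationRemoval

/-- S2a — THE NEAR-TIER CORE: REGIONAL ELASTIC ENGINE (reshape r2; size XL⁻; registered): for some `κ > 0`, `R ≥ 0`,
`C_f`, every `1/3`-separated configuration satisfies, on the region `Ω_R` of sites ALL of whose `R`-neighbours are `1/15`-close
to a Barlow shell, `κ·#(Ω_R ∩ Def₁⁄₂₀) − C_f·#Def₁⁄₁₅ ≤ Σ_{i ∈ Ω_R} (½𝓔ⁱ(x) − e_per)` (`𝓔ⁱ` = site energy, spelled as the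
`Finset.univ.erase i` sum).  Content: robust layer lemma at tolerance 1/15 (Ω_R is a strained Barlow stacking of locally constant
scale), harmonic (Born) coercivity of every Barlow stacking near its own scale for the 12-6 potential with tail (`κ ≤ 5.7e-3`:
threshold {111}/basal slip), equation-of-state rung away from `a*`, first-order terms = boundary flux and far field beyond `R`
= `O(#∂Ω_R) ≤ K_{2R}·#Def₁⁄₁₅` (charged flat per gross site).  `e_S(a) ≥ e_per` by `ciInf_le` — no value of `e_per` needed. -/
theorem stub_regionalEngine :
    ∃ κ : ℝ, 0 < κ ∧ ∃ R Cf : ℝ, 0 ≤ R ∧ ∀ (N : ℕ) (x : Fin N → EuclideanSpace ℝ (Fin 3)),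
    (∀ i j : Fin N, i ≠ j → (1 / 3 : ℝ) ≤ dist (x i) (x j)) →
    κ * ((Finset.univ.filter fun i : Fin N =>
            (∀ j : Fin N, dist (x j) (x i) ≤ R → ∃ a : ℝ, 9 / 10 ≤ a ∧ a ≤ 11 / 10 ∧
              (ShellCloseTo (1 / 15) ((Finset.univ.filter fun k : Fin N => k ≠ j ∧ dist (x j) (x k) ≤ 6 / 5).image
                  fun k => a⁻¹ • (x k - x j)) fccKissingPattern ∨
                ShellCloseTo (1 / 15) ((Finset.univ.filter fun k : Fin N => k ≠ j ∧ dist (x j) (x k) ≤ 6 / 5).image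
                  fun k => a⁻¹ • (x k - x j)) hcpKissingPattern)) ∧
            ¬ ∃ a : ℝ, 9 / 10 ≤ a ∧ a ≤ 11 / 10 ∧
              (ShellCloseTo (1 / 20) ((Finset.univ.filter fun j : Fin N => j ≠ i ∧ dist (x i) (x j) ≤ 6 / 5).image
                  fun j => a⁻¹ • (x j - x i)) fccKissingPattern ∨
                ShellCloseTo (1 / 20) ((Finset.univ.filter fun j : Fin N => j ≠ i ∧ dist (x i) (x j) ≤ 6 / 5).image
                  fun j => a⁻¹ • (x j - x i)) hcpKissingPattern)).card : ℝ)
        - Cf * (Nat.card {i : Fin N // ¬ ∃ a : ℝ, 9 / 10 ≤ a ∧ a ≤ 11 / 10 ∧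
            (ShellCloseTo (1 / 15) ((Finset.univ.filter fun j : Fin N => j ≠ i ∧ dist (x i) (x j) ≤ 6 / 5).image
                fun j => a⁻¹ • (x j - x i)) fccKissingPattern ∨
              ShellCloseTo (1 / 15) ((Finset.univ.filter fun j : Fin N => j ≠ i ∧ dist (x i) (x j) ≤ 6 / 5).image
                fun j => a⁻¹ • (x j - x i)) hcpKissingPattern)} : ℝ)
      ≤ ∑ i ∈ Finset.univ.filter (fun i : Fin N => ∀ j : Fin N, dist (x j) (x i) ≤ R →
            ∃ a : ℝ, 9 / 10 ≤ a ∧ a ≤ 11 / 10 ∧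
              (ShellCloseTo (1 / 15) ((Finset.univ.filter fun k : Fin N => k ≠ j ∧ dist (x j) (x k) ≤ 6 / 5).image
                  fun k => a⁻¹ • (x k - x j)) fccKissingPattern ∨
                ShellCloseTo (1 / 15) ((Finset.univ.filter fun k : Fin N => k ≠ j ∧ dist (x j) (x k) ≤ 6 / 5).image
                  fun k => a⁻¹ • (x k - x j)) hcpKissingPattern)),
          ((1 / 2 : ℝ) * (∑ j ∈ Finset.univ.erase i, lennardJones (dist (x i) (x j)))
            - ⨅ Q : PeriodicConfiguration 3, Q.energyPerParticle lennardJones) := by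
  sorry

/-- S2g — GLUE: regional engine ⇒ near tier (reshape r2; size M; proof ready from wave 1, `tier_step` bookkeeping):
`C_b = (6R+1)³(|e_per| + κ + 30375/2) + C_f`, `C = 0`. -/
theorem stub_elasticTierGlue :
    (∃ κ : ℝ, 0 < κ ∧ ∃ R Cf : ℝ, 0 ≤ R ∧ ∀ (N : ℕ) (x : Fin N → EuclideanSpace ℝ (Fin 3)),
    (∀ i j : Fin N, i ≠ j → (1 / 3 : ℝ) ≤ dist (x i) (x j)) →
    κ * ((Finset.univ.filter fun i : Fin N =>
            (∀ j : Fin N, dist (x j) (x i) ≤ R → ∃ a : ℝ, 9 / 10 ≤ a ∧ a ≤ 11 / 10 ∧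
              (ShellCloseTo (1 / 15) ((Finset.univ.filter fun k : Fin N => k ≠ j ∧ dist (x j) (x k) ≤ 6 / 5).image
                  fun k => a⁻¹ • (x k - x j)) fccKissingPattern ∨
                ShellCloseTo (1 / 15) ((Finset.univ.filter fun k : Fin N => k ≠ j ∧ dist (x j) (x k) ≤ 6 / 5).image
                  fun k => a⁻¹ • (x k - x j)) hcpKissingPattern)) ∧
            ¬ ∃ a : ℝ, 9 / 10 ≤ a ∧ a ≤ 11 / 10 ∧
              (ShellCloseTo (1 / 20) ((Finset.univ.filter fun j : Fin N => j ≠ i ∧ dist (x i) (x j) ≤ 6 / 5).image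
                  fun j => a⁻¹ • (x j - x i)) fccKissingPattern ∨
                ShellCloseTo (1 / 20) ((Finset.univ.filter fun j : Fin N => j ≠ i ∧ dist (x i) (x j) ≤ 6 / 5).image
                  fun j => a⁻¹ • (x j - x i)) hcpKissingPattern)).card : ℝ)
        - Cf * (Nat.card {i : Fin N // ¬ ∃ a : ℝ, 9 / 10 ≤ a ∧ a ≤ 11 / 10 ∧
            (ShellCloseTo (1 / 15) ((Finset.univ.filter fun j : Fin N => j ≠ i ∧ dist (x i) (x j) ≤ 6 / 5).image
                fun j => a⁻¹ • (x j - x i)) fccKissingPattern ∨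
              ShellCloseTo (1 / 15) ((Finset.univ.filter fun j : Fin N => j ≠ i ∧ dist (x i) (x j) ≤ 6 / 5).image
                fun j => a⁻¹ • (x j - x i)) hcpKissingPattern)} : ℝ)
      ≤ ∑ i ∈ Finset.univ.filter (fun i : Fin N => ∀ j : Fin N, dist (x j) (x i) ≤ R →
            ∃ a : ℝ, 9 / 10 ≤ a ∧ a ≤ 11 / 10 ∧
              (ShellCloseTo (1 / 15) ((Finset.univ.filter fun k : Fin N => k ≠ j ∧ dist (x j) (x k) ≤ 6 / 5).image
                  fun k => a⁻¹ • (x k - x j)) fccKissingPattern ∨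
                ShellCloseTo (1 / 15) ((Finset.univ.filter fun k : Fin N => k ≠ j ∧ dist (x j) (x k) ≤ 6 / 5).image
                  fun k => a⁻¹ • (x k - x j)) hcpKissingPattern)),
          ((1 / 2 : ℝ) * (∑ j ∈ Finset.univ.erase i, lennardJones (dist (x i) (x j)))
            - ⨅ Q : PeriodicConfiguration 3, Q.energyPerParticle lennardJones)) →
    ∃ κ : ℝ, 0 < κ ∧ ∃ Cb C : ℝ, ∀ (N : ℕ) (x : Fin N → EuclideanSpace ℝ (Fin 3)),
      (∀ i j : Fin N, i ≠ j → (1 / 3 : ℝ) ≤ dist (x i) (x j)) →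
      (N : ℝ) * (⨅ Q : PeriodicConfiguration 3, Q.energyPerParticle lennardJones)
          + κ * (Nat.card {i : Fin N // ¬ ∃ a : ℝ, 9 / 10 ≤ a ∧ a ≤ 11 / 10 ∧
              (ShellCloseTo (1 / 20) ((Finset.univ.filter fun j : Fin N => j ≠ i ∧ dist (x i) (x j) ≤ 6 / 5).image
                  fun j => a⁻¹ • (x j - x i)) fccKissingPattern ∨
                ShellCloseTo (1 / 20) ((Finset.univ.filter fun j : Fin N => j ≠ i ∧ dist (x i) (x j) ≤ 6 / 5).image
                  fun j => a⁻¹ • (x j - x i)) hcpKissingPattern)} : ℝ)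
          - Cb * (Nat.card {i : Fin N // ¬ ∃ a : ℝ, 9 / 10 ≤ a ∧ a ≤ 11 / 10 ∧
              (ShellCloseTo (1 / 15) ((Finset.univ.filter fun j : Fin N => j ≠ i ∧ dist (x i) (x j) ≤ 6 / 5).image
                  fun j => a⁻¹ • (x j - x i)) fccKissingPattern ∨
                ShellCloseTo (1 / 15) ((Finset.univ.filter fun j : Fin N => j ≠ i ∧ dist (x i) (x j) ≤ 6 / 5).image
                  fun j => a⁻¹ • (x j - x i)) hcpKissingPattern)} : ℝ)
          - C * (N : ℝ) ^ (2 / 3 : ℝ) ≤ interactionEnergy lennardJones x := by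
  sorry

/-- S2 — the near (elastic) tier, DERIVED from S2g and S2a (no sorry of its own). -/
theorem elasticTier_of_stubs :
    ∃ κ : ℝ, 0 < κ ∧ ∃ Cb C : ℝ, ∀ (N : ℕ) (x : Fin N → EuclideanSpace ℝ (Fin 3)),
      (∀ i j : Fin N, i ≠ j → (1 / 3 : ℝ) ≤ dist (x i) (x j)) →
      (N : ℝ) * (⨅ Q : PeriodicConfiguration 3, Q.energyPerParticle lennardJones)
          + κ * (Nat.card {i : Fin N // ¬ ∃ a : ℝ, 9 / 10 ≤ a ∧ a ≤ 11 / 10 ∧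
              (ShellCloseTo (1 / 20) ((Finset.univ.filter fun j : Fin N => j ≠ i ∧ dist (x i) (x j) ≤ 6 / 5).image
                  fun j => a⁻¹ • (x j - x i)) fccKissingPattern ∨
                ShellCloseTo (1 / 20) ((Finset.univ.filter fun j : Fin N => j ≠ i ∧ dist (x i) (x j) ≤ 6 / 5).image
                  fun j => a⁻¹ • (x j - x i)) hcpKissingPattern)} : ℝ)
          - Cb * (Nat.card {i : Fin N // ¬ ∃ a : ℝ, 9 / 10 ≤ a ∧ a ≤ 11 / 10 ∧
              (ShellCloseTo (1 / 15) ((Finset.univ.filter fun j : Fin N => j ≠ i ∧ dist (x i) (x j) ≤ 6 / 5).image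
                  fun j => a⁻¹ • (x j - x i)) fccKissingPattern ∨
                ShellCloseTo (1 / 15) ((Finset.univ.filter fun j : Fin N => j ≠ i ∧ dist (x i) (x j) ≤ 6 / 5).image
                  fun j => a⁻¹ • (x j - x i)) hcpKissingPattern)} : ℝ)
          - C * (N : ℝ) ^ (2 / 3 : ℝ) ≤ interactionEnergy lennardJones x :=
  stub_elasticTierGlue stub_regionalEngine

example : ElasticTier := elasticTier_of_stubs

/-- S3p — THE FAR (LP) TIER ON THE TORUS AT TOLERANCE 1/15 (reshape r1; size XL; HARDEST — held by the lead): the route's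
Regge/Delaunay-star LP engine (flatness identities 13607/13608, sliver exudation, octahedra booking, `e_per` eliminated against the
explicit `e(hcp(a,h)) + g₁` on charged stars) at resolution `≈ 1e-2`, in its cleanest home: a finite Delaunay complex on `ℝ³/Λ`,
exact flatness at every vertex and edge, no boundary, `C = 0`.  Separation `1/3` of the point set is part of the hypothesis. -/
theorem stub_coarseTierPeriodic :
    ∃ g₁ : ℝ, 0 < g₁ ∧ ∀ P : Literature.MathematicalPhysics.StatisticalMechanics.PeriodicConfiguration 3,
      (∀ u ∈ P.points, ∀ v ∈ P.points, u ≠ v → (1 / 3 : ℝ) ≤ dist u v) →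
      (⨅ Q : Literature.MathematicalPhysics.StatisticalMechanics.PeriodicConfiguration 3,
          Q.energyPerParticle Literature.MathematicalPhysics.StatisticalMechanics.lennardJones)
        + g₁ * ((P.motif.filter fun s => ¬ ∃ a : ℝ, 9 / 10 ≤ a ∧ a ≤ 11 / 10 ∧
            (Literature.Geometry.DiscreteGeometry.ShellCloseTo (1 / 15)
                ((P.finite_inter_points (Metric.isBounded_closedBall.subset Set.sdiff_subset :
                  Bornology.IsBounded (Metric.closedBall s (6 / 5) \ {s}))).toFinset.image fun y => a⁻¹ • (y - s))
                Literature.Geometry.DiscreteGeometry.fccKissingPattern ∨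
              Literature.Geometry.DiscreteGeometry.ShellCloseTo (1 / 15)
                ((P.finite_inter_points (Metric.isBounded_closedBall.subset Set.sdiff_subset :
                  Bornology.IsBounded (Metric.closedBall s (6 / 5) \ {s}))).toFinset.image fun y => a⁻¹ • (y - s))
                Literature.Geometry.DiscreteGeometry.hcpKissingPattern)).card : ℝ)
          / (P.motif.card : ℝ)
        ≤ P.energyPerParticle Literature.MathematicalPhysics.StatisticalMechanics.lennardJones := by
  sorry

example : CoarseTierPeriodic := stub_coarseTierPeriodic

/-- S3t — TRANSFER TORUS → FINITE (reshape r1; size M; provable now by the Disproof §5/§9 pattern): periodise a `1/3`-separated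
`x : Fin N → ℝ³` (`N ≥ 1`) with the cubic lattice `Lℤ³`, `L = 2Σ‖xᵢ‖ + 2` (`Literature.Barriers.AtomisticToContinuum.cubicLattice`):
the periodisation is `1/3`-separated (copies are `≥ 2` apart), its motif is `univ.image x` (card `N`), its shells read in `P.points`
within radius `6/5` are exactly the shells of `x` (so the `1/15`-gross motif count is `#Def₁⁄₁₅(x)`), and `e(P) ≤ E_LJ(x)/N` because every
cross term is `V_LJ(r) ≤ 0` (`r ≥ 1`; `sum_le_hasSum` on the negated summable lattice sum, `hasSum_lennardJones_dist_three`).  Multiply by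
`N`; `N = 0` is trivial.  Gives S3 with `C = 0`. -/
theorem stub_coarseTierTransfer :
    (∃ g₁ : ℝ, 0 < g₁ ∧ ∀ P : Literature.MathematicalPhysics.StatisticalMechanics.PeriodicConfiguration 3,
      (∀ u ∈ P.points, ∀ v ∈ P.points, u ≠ v → (1 / 3 : ℝ) ≤ dist u v) →
      (⨅ Q : Literature.MathematicalPhysics.StatisticalMechanics.PeriodicConfiguration 3,
          Q.energyPerParticle Literature.MathematicalPhysics.StatisticalMechanics.lennardJones)
        + g₁ * ((P.motif.filter fun s => ¬ ∃ a : ℝ, 9 / 10 ≤ a ∧ a ≤ 11 / 10 ∧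
            (Literature.Geometry.DiscreteGeometry.ShellCloseTo (1 / 15)
                ((P.finite_inter_points (Metric.isBounded_closedBall.subset Set.sdiff_subset :
                  Bornology.IsBounded (Metric.closedBall s (6 / 5) \ {s}))).toFinset.image fun y => a⁻¹ • (y - s))
                Literature.Geometry.DiscreteGeometry.fccKissingPattern ∨
              Literature.Geometry.DiscreteGeometry.ShellCloseTo (1 / 15)
                ((P.finite_inter_points (Metric.isBounded_closedBall.subset Set.sdiff_subset :
                  Bornology.IsBounded (Metric.closedBall s (6 / 5) \ {s}))).toFinset.image fun y => a⁻¹ • (y - s))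
                Literature.Geometry.DiscreteGeometry.hcpKissingPattern)).card : ℝ)
          / (P.motif.card : ℝ)
        ≤ P.energyPerParticle Literature.MathematicalPhysics.StatisticalMechanics.lennardJones) →
    ∃ g₁ : ℝ, 0 < g₁ ∧ ∃ C : ℝ, ∀ (N : ℕ) (x : Fin N → EuclideanSpace ℝ (Fin 3)),
      (∀ i j : Fin N, i ≠ j → (1 / 3 : ℝ) ≤ dist (x i) (x j)) →
      (N : ℝ) * (⨅ Q : PeriodicConfiguration 3, Q.energyPerParticle lennardJones)
          + g₁ * (Nat.card {i : Fin N // ¬ ∃ a : ℝ, 9 / 10 ≤ a ∧ a ≤ 11 / 10 ∧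
              (ShellCloseTo (1 / 15) ((Finset.univ.filter fun j : Fin N => j ≠ i ∧ dist (x i) (x j) ≤ 6 / 5).image
                  fun j => a⁻¹ • (x j - x i)) fccKissingPattern ∨
                ShellCloseTo (1 / 15) ((Finset.univ.filter fun j : Fin N => j ≠ i ∧ dist (x i) (x j) ≤ 6 / 5).image
                  fun j => a⁻¹ • (x j - x i)) hcpKissingPattern)} : ℝ)
          - C * (N : ℝ) ^ (2 / 3 : ℝ) ≤ interactionEnergy lennardJones x := by
  sorry

example : CoarseTierPeriodic → CoarseTier := stub_coarseTierTransfer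

/-- S3 — the far tier on finite separated configurations, DERIVED from S3t and S3p (no sorry of its own). -/
theorem coarseTier_of_stubs :
    ∃ g₁ : ℝ, 0 < g₁ ∧ ∃ C : ℝ, ∀ (N : ℕ) (x : Fin N → EuclideanSpace ℝ (Fin 3)),
      (∀ i j : Fin N, i ≠ j → (1 / 3 : ℝ) ≤ dist (x i) (x j)) →
      (N : ℝ) * (⨅ Q : PeriodicConfiguration 3, Q.energyPerParticle lennardJones)
          + g₁ * (Nat.card {i : Fin N // ¬ ∃ a : ℝ, 9 / 10 ≤ a ∧ a ≤ 11 / 10 ∧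
              (ShellCloseTo (1 / 15) ((Finset.univ.filter fun j : Fin N => j ≠ i ∧ dist (x i) (x j) ≤ 6 / 5).image
                  fun j => a⁻¹ • (x j - x i)) fccKissingPattern ∨
                ShellCloseTo (1 / 15) ((Finset.univ.filter fun j : Fin N => j ≠ i ∧ dist (x i) (x j) ≤ 6 / 5).image
                  fun j => a⁻¹ • (x j - x i)) hcpKissingPattern)} : ℝ)
          - C * (N : ℝ) ^ (2 / 3 : ℝ) ≤ interactionEnergy lennardJones x :=
  stub_coarseTierTransfer stub_coarseTierPeriodic

example : CoarseTier := coarseTier_of_stubs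

/-! ## The kernel-checked composition -/

/-- **The convex-combination glue, as pure real arithmetic.** From the near tier
`e + κ·D₂₀ − C_b·D₁₅ − C₂·t ≤ X` and the far tier `e + g₁·D₁₅ − C₃·t ≤ X` (`g₁ > 0`, `D₁₅ ≥ 0`):
`e + (g₁κ/(g₁+B))·D₂₀ − ((g₁C₂ + B·C₃)/(g₁+B))·t ≤ X` with `B = max C_b 0` — the `D₁₅` terms cancel exactly. -/
theorem convex_glue {e D₂₀ D₁₅ t X κ Cb C₂ g₁ C₃ : ℝ} (hg₁ : 0 < g₁) (hD : 0 ≤ D₁₅)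
    (h₂ : e + κ * D₂₀ - Cb * D₁₅ - C₂ * t ≤ X) (h₃ : e + g₁ * D₁₅ - C₃ * t ≤ X) :
    e + g₁ * κ / (g₁ + max Cb 0) * D₂₀ - (g₁ * C₂ + max Cb 0 * C₃) / (g₁ + max Cb 0) * t ≤ X := by
  set B : ℝ := max Cb 0 with hB
  have hB0 : 0 ≤ B := le_max_right _ _
  have hCbB : Cb ≤ B := le_max_left _ _
  have hden : 0 < g₁ + B := by linarith
  have h₂' : e + κ * D₂₀ - B * D₁₅ - C₂ * t ≤ X := by
    have : Cb * D₁₅ ≤ B * D₁₅ := mul_le_mul_of_nonneg_right hCbB hD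
    linarith
  have a₁ := mul_le_mul_of_nonneg_left h₂' hg₁.le
  have a₂ := mul_le_mul_of_nonneg_left h₃ hB0
  have key : (g₁ + B) * (e + g₁ * κ / (g₁ + B) * D₂₀ - (g₁ * C₂ + B * C₃) / (g₁ + B) * t) =
      g₁ * (e + κ * D₂₀ - B * D₁₅ - C₂ * t) + B * (e + g₁ * D₁₅ - C₃ * t) := by
    field_simp
    ring
  have hmul : (g₁ + B) * (e + g₁ * κ / (g₁ + B) * D₂₀ - (g₁ * C₂ + B * C₃) / (g₁ + B) * t) ≤ (g₁ + B) * X := by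
    rw [key]
    linarith
  exact le_of_mul_le_mul_left hmul hden

/-- **Pure logic of the line** (no sorry, no stub used): S1 → S2 → S3 → the crux, the latter written unfolded once
(`starCoercivity_iff` is `Iff.rfl`) so that this documentation theorem is not itself a by-name candidate. -/
theorem composition :
    SeparationRemoval → ElasticTier → CoarseTier →
      ∃ g : ℝ, 0 < g ∧ ∃ C : ℝ, ∀ (N : ℕ) (x : Fin N → E3), Function.Injective x →
        (N : ℝ) * ePer + g * (defectsAt (1 / 20) x : ℝ) - C * (N : ℝ) ^ (2 / 3 : ℝ) ≤
          interactionEnergy lennardJones x := by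
  intro hS hE hC
  obtain ⟨κ, hκ, Cb, C₂, h₂⟩ := hE
  obtain ⟨g₁, hg₁, C₃, h₃⟩ := hC
  refine hS ⟨g₁ * κ / (g₁ + max Cb 0), ?_, (g₁ * C₂ + max Cb 0 * C₃) / (g₁ + max Cb 0), fun N x hx => ?_⟩
  · have : 0 < g₁ + max Cb 0 := by have := le_max_right Cb 0; linarith
    exact div_pos (mul_pos hg₁ hκ) this
  · exact convex_glue hg₁ (Nat.cast_nonneg _) (h₂ N x hx) (h₃ N x hx)

/-- **The line concludes the crux BY NAME.** S1 (landed), S2 = S2g ∘ S2a, S3 = S3t ∘ S3p fed into `composition`; no sorry of its own. -/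
theorem StarCoercivity_of : Summit.AtomisticToContinuum.Crystallization.Theses.ReggeStarCoercivity.StarCoercivity :=
  starCoercivity_iff.2 (composition stub_separationRemoval elasticTier_of_stubs coarseTier_of_stubs)

end Summit.AtomisticToContinuum.Crystallization.Cruxes.StarCoercivity.ElasticTierOverlapSplit

end
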